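import Summits.QuantumAdvantage.AdviceFreeQNC0.AffBells22KernelZeros
import HarnessLib

/-!
# L4 (BLIND/THIN TAIL of the HWide line), typed and proved (qn-lit g29; sketch, ns `AffBells29lit`)

qn-p1 g29 (INBOX 2026-08-28T19:49Z, N-29b): «P_x[|S ∩ zeros(kline x)| ≤ 2] ≤ poly(|S|)·ρ^{|S|}» for every fixed set `S` of
positions — the wide rows that are BLIND or THIN at the fibre are exponentially rare in their support size.  This is Markov's
inequality on the tree's exponential moment `AffBells22.kernelZerosOnSetMGF`
(`Σ_{x odd} 2^{−|D ∩ zeros J(x)|} ≤ C·κ^{|D|}·2^{n−1}`, `κ < 1` absolute; proved there with `C = 160/29`, `κ = 29/32`):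
`#{x odd : |D ∩ zeros(J x)| ≤ t} ≤ 2^t·C·κ^{|D|}·2^{n−1}` for every `t` (`thinTail`).
-/

namespace Summit.QuantumAdvantage.AdviceFreeQNC0

namespace AffBells29lit

open Finset Literature.Computability.QuantumComplexity Literature.Computability.QuantumComplexity.RingHLF
open Fib19 AffBells22

/-- **L4 — thin/blind tail of the kernel line on a fixed set.**  There are absolute `κ < 1` and `C` such that for every
`n ≥ 3`, every set `D` of positions and every `t`, at most `2^t·C·κ^{|D|}·2^{n−1}` odd inputs `x` have at most `t` zeros of
the kernel line `J(x)` inside `D` (Markov on `kernelZerosOnSetMGF`).  For a wide row (`|D| > C' log₂ N`) and `t = 2` this is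
the `N^{1−c C'}`-rarity of blind / thin wide rows used by the frame shadow. -/
theorem thinTail : ∃ κ : ℝ, κ < 1 ∧ ∃ C : ℝ, ∀ n ≥ 3, ∀ (D : Finset (Fin n)) (t : ℕ),
    (((univ.filter fun x : Fin n → Bool =>
        IsOdd x ∧ (D.filter fun i => kline x i = false).card ≤ t).card : ℕ) : ℝ)
      ≤ (2 : ℝ) ^ t * (C * κ ^ D.card * (2 : ℝ) ^ (n - 1)) := by
  classical
  obtain ⟨κ, hκ, C, hC⟩ := kernelZerosOnSetMGF
  refine ⟨κ, hκ, C, fun n hn D t => ?_⟩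
  have hmgf := hC n hn D
  set thin : Finset (Fin n → Bool) :=
    univ.filter fun x : Fin n → Bool => IsOdd x ∧ (D.filter fun i => kline x i = false).card ≤ t with hthin
  set odd : Finset (Fin n → Bool) := univ.filter fun x : Fin n → Bool => IsOdd x with hodd
  have hsub : thin ⊆ odd := by
    intro x hx
    rw [hthin, mem_filter] at hx
    rw [hodd, mem_filter]
    exact ⟨hx.1, hx.2.1⟩
  -- on the thin set every term 2^t · 2^{-Z_D} is at least 1
  have hterm : ∀ x ∈ thin, (1 : ℝ) ≤ (2 : ℝ) ^ t * ((2 : ℝ)⁻¹) ^ (D.filter fun i => kline x i = false).card := by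
    intro x hx
    rw [hthin, mem_filter] at hx
    obtain ⟨-, -, hle⟩ := hx
    set z := (D.filter fun i => kline x i = false).card with hz
    have hpow : ((2 : ℝ)⁻¹) ^ t ≤ ((2 : ℝ)⁻¹) ^ z :=
      pow_le_pow_of_le_one (by norm_num) (by norm_num) hle
    calc (1 : ℝ) = (2 : ℝ) ^ t * ((2 : ℝ)⁻¹) ^ t := by rw [← mul_pow]; norm_num
      _ ≤ (2 : ℝ) ^ t * ((2 : ℝ)⁻¹) ^ z := mul_le_mul_of_nonneg_left hpow (by positivity)
  calc ((thin.card : ℕ) : ℝ) = ∑ x ∈ thin, (1 : ℝ) := by simp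
    _ ≤ ∑ x ∈ thin, (2 : ℝ) ^ t * ((2 : ℝ)⁻¹) ^ (D.filter fun i => kline x i = false).card := sum_le_sum hterm
    _ ≤ ∑ x ∈ odd, (2 : ℝ) ^ t * ((2 : ℝ)⁻¹) ^ (D.filter fun i => kline x i = false).card :=
        sum_le_sum_of_subset_of_nonneg hsub fun x _ _ => by positivity
    _ = (2 : ℝ) ^ t * ∑ x ∈ odd, ((2 : ℝ)⁻¹) ^ (D.filter fun i => kline x i = false).card := by rw [mul_sum]
    _ ≤ (2 : ℝ) ^ t * (C * κ ^ D.card * (2 : ℝ) ^ (n - 1)) := mul_le_mul_of_nonneg_left hmgf (by positivity)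

end AffBells29lit

end Summit.QuantumAdvantage.AdviceFreeQNC0
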